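import Summits.QuantumFields.YangMills.Theorems.FluctuationComparisonRegPrIntLS2BetaLogChordComparison
import Summits.QuantumFields.YangMills.Theorems.FluctuationComparisonRegPrIntLS2BetaGeodesicJensenLift
import Summits.QuantumFields.YangMills.Theorems.FluctuationComparisonRegPrIntLS2BetaCombTransporter
import Summits.QuantumFields.YangMills.Theorems.FluctuationComparisonRegPrIntLS2BetaWhitneyHatLiftCurvatureSecondOrder
import HarnessLib

/-!
# S2β · (R1) IN SUP ∕ RELATIVE-CHORD FORM — the geodesic hat lift CONTRACTS relative chords bondwise:
# `dist1 (lift X b · (lift X′ b)⁻¹) ≤ (1 + s²∕3)·L⁻¹·max_{e : w b e ≠ 0} dist1 (X e·X′ e⁻¹)` and `‖logVec (…)‖ ≤ (π∕2)(1 + s²∕3)·L⁻¹·max (…)` for arcs `≤ s`, `s² ≤ 3`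
# — the letter px16 g22 17:08:47Z (γ) asked for by name («(R1)-sup-relative with its constant `c_lift`»; lane sentence `C_Ax = (c_lift, ℓ_lad, m_d)`)

Cell `ym3-torus` (rung R3 = continuum `SU(2)` Yang–Mills on the three-torus — NOT d = 4, NOT infinite volume, NOT a mass gap, NOT Clay).
Width seat «width 12» `ym3-torus-px12` (gen 25), FREE px helper on crux `stmt-QuantumFields-20520`; `--kind proof --supports stmt-QuantumFields-20520 --as helper`,
count-neutral, DEFINITION-FREE (0 `def`, 0 `instance`, 0 `notation`, 0 `sorry`, default heartbeats; weights `w`, lifts `V, V′` pinned by px12 g23's `hw`∕`hV`).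

WHAT.  px12 g23's ✓p820752 `…WhitneyHatLiftRelative` has (R1) in `ℓ²` form (`sum_dist1_sq_lift_mul_inv_le`) and the SUP companion in LOG-DIFFERENCE currency
(`norm_logVec_lift_sub_le : ‖log V b − log V′ b‖ ≤ L⁻¹·r`, constant ONE); px21 g24's ✓p828950 `norm_logVec_lift_sub_shift_le` is the variation twin.  The (SCT) → (ST)
discharger of the pairing lane (px17 §94.5 (D), px16 g22's lane sentence 17:08:47Z) reads chords in RELATIVE-CHORD currency on BOTH sides — this file is that edition:
* §1 ★`dist1_lift_rel_le_of_logVec_sub` — `dist1 (V b·V′ b⁻¹) ≤ L⁻¹·r` from `‖log X e − log X′ e‖ ≤ r` on the support (✓`norm_logVec_lift_sub_le` + ✓`dist1_expPoint_mul_inv_expPoint_le`);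
* §2 ★★`dist1_lift_rel_le` — `dist1 (V b·V′ b⁻¹) ≤ (1 + s²∕3)·(L⁻¹·m)` from `dist1 (X e·X′ e⁻¹) ≤ m` and arcs `≤ s` on the support, `s² ≤ 3` (✓p822698 `norm_logVec_sub_le_mul_dist1`);
  ★★`norm_logVec_lift_rel_le` — `‖logVec (su2Quat (V b·V′ b⁻¹))‖ ≤ (π∕2)·((1 + s²∕3)·(L⁻¹·m))` (Jordan ✓`norm_logVec_le_pi_div_two_mul_dist1`), i.e. **`c_lift = (π∕2)(1 + s²∕3) ≤ π`**;
  ★`norm_logVec_lift_rel_le_of_logVec` — the same from `‖logVec (su2Quat (X e·X′ e⁻¹))‖ ≤ m` (✓`dist1_le_norm_logVec`), px16's displayed shape VERBATIM up to the constant;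
* §3 ★★`norm_logVec_lift_rel_sub_shift_le` — the RELATIVE VARIATION edition (px16 g22 17:10:38Z (2) «V ≤ L⁻²V_{t−1}, RELATIVE edition wanted»): the adjacent transverse
  variation of the log-DIFFERENCE field `log V − log V′` contracts by `(L⁻¹)²`, constant ONE, NO size hypothesis (px21 g24's ✓`norm_logVec_lift_sub_shift_le` applied to the
  difference field — the hat lift is linear in the logs; ✓`norm_sub_shift_hat_le`).
No commutator slack is needed: the hat lift is log-linear, so the contraction is exact in log currency and the only price is the chart comparison `(1 + s²∕3)` and Jordan's `π∕2`.

HONEST SCOPE.  Four short compositions of landed letters; nothing of Bałaban's analysis asserted ([Balaban1985RegularSpaces] (1.29) p.81, Lemma 1 p.79 served; the hat lift after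
[Balaban1984PropagatorsI] (1.7) p.18); (ST)∕(SCT)∕LOC, D-GUARD, GAP♯∘ (registry 3732b7df UNTOUCHED, 0∕5), S2β, crux 20520 and `YM3TorusSU2` NOT proved; no registered stub closed;
rung R3 = SU(2) YM₃ on T³ — NOT d = 4, NOT infinite volume, NOT a mass gap, NOT Clay; the Yang–Mills mass gap is NOT proved.
-/

set_option autoImplicit false

namespace Summit.QuantumFields.YangMills.Theorems.FluctuationComparisonRegPrIntLS2BetaWhitneyHatLiftRelativeSup

open Finset
open scoped Real
open Literature.MathematicalPhysics.QuantumLattice (su2Quat)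
open Literature.MathematicalPhysics.QuantumFieldTheory.Balaban1983to89
open B10Eq27TorusAxialLog (rel)
open T4CubeChartGnomonic (SU2)
open T4HaarSU2ExpChart (expPoint)
open T4ExpWindowSmallField (logVec expPoint_logVec)
open Summit.QuantumFields.YangMills.Theorems.FluctuationComparisonRegPrIntLS2BetaWhitneyHatLiftRelative
  (norm_logVec_lift_sub_le dist1_expPoint_mul_inv_expPoint_le logVec_lift)
open Summit.QuantumFields.YangMills.Theorems.FluctuationComparisonRegPrIntLS2BetaWhitneyHatLiftCurvatureSecondOrder (norm_sub_shift_hat_le)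
open Summit.QuantumFields.YangMills.Theorems.FluctuationComparisonRegPrIntLS2BetaLogChordComparison (norm_logVec_sub_le_mul_dist1)
open Summit.QuantumFields.YangMills.Theorems.FluctuationComparisonRegPrIntLS2BetaDistributedHolonomySU2 (norm_logVec_le_pi_div_two_mul_dist1)
open Summit.QuantumFields.YangMills.Theorems.FluctuationComparisonRegPrIntLS2BetaGeodesicJensenLift (dist1_le_norm_logVec)

variable {P : Params} {t : ℕ}

/-! ## §1 Relative chord of the lifts from the log-difference of the coarse fields -/

/-- ★ **(R1)-sup, chord on the left**: if every coarse bond feeding `b` has `‖log X e − log X′ e‖ ≤ r`, then `dist1 (V b·V′ b⁻¹) ≤ L⁻¹·r`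
(✓`norm_logVec_lift_sub_le` read through `V b = exp(log V b)` and the chord ≤ log-difference letter). [cite: Balaban1985RegularSpaces, (1.29) p.81] -/
theorem dist1_lift_rel_le_of_logVec_sub (ht : t + 1 ≤ P.m + P.K) (w : PBond P t → PBond P (t + 1) → ℝ)
    (hw : ∀ b e, w b e = if e.dir = b.dir ∧ (b.src b.dir - emb e.src b.dir).val < P.L then
      ∏ ν ∈ Finset.univ.erase b.dir, max 0 (1 - ((rel (emb e.src) b.src ν).natAbs : ℝ) / P.L) else 0)
    (X X' : GaugeField P (t + 1) SU2) (V V' : GaugeField P t SU2)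
    (hV : ∀ b, V b = expPoint (∑ e, w b e • ((P.L : ℝ)⁻¹ • logVec (su2Quat (X e)))))
    (hV' : ∀ b, V' b = expPoint (∑ e, w b e • ((P.L : ℝ)⁻¹ • logVec (su2Quat (X' e)))))
    (b : PBond P t) {r : ℝ} (hr : ∀ e, w b e ≠ 0 → ‖logVec (su2Quat (X e)) - logVec (su2Quat (X' e))‖ ≤ r) :
    dist1 (V b * (V' b)⁻¹) ≤ (P.L : ℝ)⁻¹ * r := by
  have h := norm_logVec_lift_sub_le ht w hw X X' V V' hV hV' b hr
  have hc : dist1 (V b * (V' b)⁻¹) ≤ ‖logVec (su2Quat (V b)) - logVec (su2Quat (V' b))‖ := by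
    conv_lhs => rw [← expPoint_logVec (V b), ← expPoint_logVec (V' b)]
    exact dist1_expPoint_mul_inv_expPoint_le _ _
  exact hc.trans h

/-! ## §2 Relative chord ∕ relative log of the lifts from the relative chords of the coarse fields -/

/-- ★★ **(R1)-sup, chord currency both sides**: arcs `≤ s` (`s² ≤ 3`) and relative chords `dist1 (X e·X′ e⁻¹) ≤ m` on the support of `b` give
`dist1 (V b·V′ b⁻¹) ≤ (1 + s²∕3)·(L⁻¹·m)` (§1 + ✓p822698 `norm_logVec_sub_le_mul_dist1`). [cite: Balaban1985RegularSpaces, (1.29) p.81] -/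
theorem dist1_lift_rel_le (ht : t + 1 ≤ P.m + P.K) (w : PBond P t → PBond P (t + 1) → ℝ)
    (hw : ∀ b e, w b e = if e.dir = b.dir ∧ (b.src b.dir - emb e.src b.dir).val < P.L then
      ∏ ν ∈ Finset.univ.erase b.dir, max 0 (1 - ((rel (emb e.src) b.src ν).natAbs : ℝ) / P.L) else 0)
    (X X' : GaugeField P (t + 1) SU2) (V V' : GaugeField P t SU2)
    (hV : ∀ b, V b = expPoint (∑ e, w b e • ((P.L : ℝ)⁻¹ • logVec (su2Quat (X e)))))
    (hV' : ∀ b, V' b = expPoint (∑ e, w b e • ((P.L : ℝ)⁻¹ • logVec (su2Quat (X' e)))))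
    (b : PBond P t) {s m : ℝ}
    (hs : ∀ e, w b e ≠ 0 → ‖logVec (su2Quat (X e))‖ ≤ s) (hs' : ∀ e, w b e ≠ 0 → ‖logVec (su2Quat (X' e))‖ ≤ s) (hs3 : s ^ 2 ≤ 3)
    (hm : ∀ e, w b e ≠ 0 → dist1 (X e * (X' e)⁻¹) ≤ m) :
    dist1 (V b * (V' b)⁻¹) ≤ (1 + s ^ 2 / 3) * ((P.L : ℝ)⁻¹ * m) := by
  have h := dist1_lift_rel_le_of_logVec_sub ht w hw X X' V V' hV hV' b (r := (1 + s ^ 2 / 3) * m) fun e he =>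
    (norm_logVec_sub_le_mul_dist1 (X e) (X' e) (hs e he) (hs' e he) hs3).trans
      (mul_le_mul_of_nonneg_left (hm e he) (by positivity))
  calc dist1 (V b * (V' b)⁻¹) ≤ (P.L : ℝ)⁻¹ * ((1 + s ^ 2 / 3) * m) := h
    _ = (1 + s ^ 2 / 3) * ((P.L : ℝ)⁻¹ * m) := by ring

/-- ★★ **(R1)-sup, relative LOG on the left**: under §2's hypotheses `‖logVec (su2Quat (V b·V′ b⁻¹))‖ ≤ (π∕2)·((1 + s²∕3)·(L⁻¹·m))` — the lane's
`c_lift = (π∕2)(1 + s²∕3) ≤ π` (Jordan ✓`norm_logVec_le_pi_div_two_mul_dist1`). [cite: Balaban1985RegularSpaces, (1.29) p.81] -/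
theorem norm_logVec_lift_rel_le (ht : t + 1 ≤ P.m + P.K) (w : PBond P t → PBond P (t + 1) → ℝ)
    (hw : ∀ b e, w b e = if e.dir = b.dir ∧ (b.src b.dir - emb e.src b.dir).val < P.L then
      ∏ ν ∈ Finset.univ.erase b.dir, max 0 (1 - ((rel (emb e.src) b.src ν).natAbs : ℝ) / P.L) else 0)
    (X X' : GaugeField P (t + 1) SU2) (V V' : GaugeField P t SU2)
    (hV : ∀ b, V b = expPoint (∑ e, w b e • ((P.L : ℝ)⁻¹ • logVec (su2Quat (X e)))))
    (hV' : ∀ b, V' b = expPoint (∑ e, w b e • ((P.L : ℝ)⁻¹ • logVec (su2Quat (X' e)))))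
    (b : PBond P t) {s m : ℝ}
    (hs : ∀ e, w b e ≠ 0 → ‖logVec (su2Quat (X e))‖ ≤ s) (hs' : ∀ e, w b e ≠ 0 → ‖logVec (su2Quat (X' e))‖ ≤ s) (hs3 : s ^ 2 ≤ 3)
    (hm : ∀ e, w b e ≠ 0 → dist1 (X e * (X' e)⁻¹) ≤ m) :
    ‖logVec (su2Quat (V b * (V' b)⁻¹))‖ ≤ π / 2 * ((1 + s ^ 2 / 3) * ((P.L : ℝ)⁻¹ * m)) :=
  (norm_logVec_le_pi_div_two_mul_dist1 _).trans
    (mul_le_mul_of_nonneg_left (dist1_lift_rel_le ht w hw X X' V V' hV hV' b hs hs' hs3 hm) (by positivity))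

/-- ★ **(R1)-sup, relative LOG both sides** (px16 g22's displayed shape): from `‖logVec (su2Quat (X e·X′ e⁻¹))‖ ≤ m` on the support (chord ≤ arc,
✓`dist1_le_norm_logVec`), `‖logVec (su2Quat (V b·V′ b⁻¹))‖ ≤ (π∕2)·((1 + s²∕3)·(L⁻¹·m))`. [cite: Balaban1985RegularSpaces, (1.29) p.81] -/
theorem norm_logVec_lift_rel_le_of_logVec (ht : t + 1 ≤ P.m + P.K) (w : PBond P t → PBond P (t + 1) → ℝ)
    (hw : ∀ b e, w b e = if e.dir = b.dir ∧ (b.src b.dir - emb e.src b.dir).val < P.L then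
      ∏ ν ∈ Finset.univ.erase b.dir, max 0 (1 - ((rel (emb e.src) b.src ν).natAbs : ℝ) / P.L) else 0)
    (X X' : GaugeField P (t + 1) SU2) (V V' : GaugeField P t SU2)
    (hV : ∀ b, V b = expPoint (∑ e, w b e • ((P.L : ℝ)⁻¹ • logVec (su2Quat (X e)))))
    (hV' : ∀ b, V' b = expPoint (∑ e, w b e • ((P.L : ℝ)⁻¹ • logVec (su2Quat (X' e)))))
    (b : PBond P t) {s m : ℝ}
    (hs : ∀ e, w b e ≠ 0 → ‖logVec (su2Quat (X e))‖ ≤ s) (hs' : ∀ e, w b e ≠ 0 → ‖logVec (su2Quat (X' e))‖ ≤ s) (hs3 : s ^ 2 ≤ 3)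
    (hm : ∀ e, w b e ≠ 0 → ‖logVec (su2Quat (X e * (X' e)⁻¹))‖ ≤ m) :
    ‖logVec (su2Quat (V b * (V' b)⁻¹))‖ ≤ π / 2 * ((1 + s ^ 2 / 3) * ((P.L : ℝ)⁻¹ * m)) :=
  norm_logVec_lift_rel_le ht w hw X X' V V' hV hV' b hs hs' hs3 fun e he => (dist1_le_norm_logVec _).trans (hm e he)

/-! ## §3 The relative VARIATION edition: the log-difference field's adjacent transverse variation contracts by `L⁻²` -/

/-- ★★ **(R1)-variation, RELATIVE**: if the coarse log-difference field `D := log X − log X′` has adjacent transverse variation `‖D⟨y+e_ι,κ⟩ − D⟨y,κ⟩‖ ≤ v` (`ι ≠ κ`),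
then the lifts' log-difference field has `‖(log V − log V′)⟨z+e_ι,κ⟩ − (log V − log V′)⟨z,κ⟩‖ ≤ (L⁻¹)²·v` — constant ONE, no size hypothesis (the hat lift is LINEAR in the
logs: ✓`logVec_lift`; then ✓`norm_sub_shift_hat_le` on the difference field, exactly as px21 g24's one-field ✓`norm_logVec_lift_sub_shift_le`). [cite: Balaban1985RegularSpaces, (1.29) p.81] -/
theorem norm_logVec_lift_rel_sub_shift_le (ht : t + 1 ≤ P.m + P.K) (w : PBond P t → PBond P (t + 1) → ℝ)
    (hw : ∀ b e, w b e = if e.dir = b.dir ∧ (b.src b.dir - emb e.src b.dir).val < P.L then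
      ∏ ν ∈ Finset.univ.erase b.dir, max 0 (1 - ((rel (emb e.src) b.src ν).natAbs : ℝ) / P.L) else 0)
    (X X' : GaugeField P (t + 1) SU2) (V V' : GaugeField P t SU2)
    (hV : ∀ b, V b = expPoint (∑ e, w b e • ((P.L : ℝ)⁻¹ • logVec (su2Quat (X e)))))
    (hV' : ∀ b, V' b = expPoint (∑ e, w b e • ((P.L : ℝ)⁻¹ • logVec (su2Quat (X' e)))))
    {v : ℝ} (hv : ∀ (y : Site P (t + 1)) (ι κ : Fin P.d), ι ≠ κ →
      ‖(logVec (su2Quat (X ⟨y.shift ι, κ⟩)) - logVec (su2Quat (X' ⟨y.shift ι, κ⟩)))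
        - (logVec (su2Quat (X ⟨y, κ⟩)) - logVec (su2Quat (X' ⟨y, κ⟩)))‖ ≤ v)
    (z : Site P t) {ι κ : Fin P.d} (hικ : ι ≠ κ) :
    ‖(logVec (su2Quat (V ⟨z.shift ι, κ⟩)) - logVec (su2Quat (V' ⟨z.shift ι, κ⟩)))
        - (logVec (su2Quat (V ⟨z, κ⟩)) - logVec (su2Quat (V' ⟨z, κ⟩)))‖ ≤ ((P.L : ℝ)⁻¹) ^ 2 * v := by
  have hL0 : 0 ≤ (P.L : ℝ)⁻¹ := inv_nonneg.mpr (Nat.cast_nonneg _)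
  -- the log-difference of the lifts is the hat sum of the coarse log-difference field (linearity)
  set A : PBond P (t + 1) → EuclideanSpace ℝ (Fin 3) :=
    fun e => (P.L : ℝ)⁻¹ • (logVec (su2Quat (X e)) - logVec (su2Quat (X' e))) with hA
  have ha : ∀ b, logVec (su2Quat (V b)) - logVec (su2Quat (V' b)) = ∑ e, w b e • A e := fun b => by
    rw [logVec_lift ht w hw X V hV, logVec_lift ht w hw X' V' hV', ← Finset.sum_sub_distrib]
    refine Finset.sum_congr rfl fun e _ => ?_
    rw [hA]; dsimp only; rw [smul_sub, smul_sub]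
  rw [ha, ha, norm_sub_rev]
  have h := norm_sub_shift_hat_le ht w hw A (fun b => ∑ e, w b e • A e) (fun _ => rfl) z hικ (M := (P.L : ℝ)⁻¹ * v)
    fun y _ => by
      rw [hA]; dsimp only
      rw [← smul_sub, norm_smul, Real.norm_eq_abs, abs_of_nonneg hL0, norm_sub_rev]
      exact mul_le_mul_of_nonneg_left (hv y ι κ hικ) hL0
  refine h.trans (le_of_eq ?_)
  ring

/-! ## §4 (px21 g24 append, px12 g25 «GO — yours» 17:13:05Z) Support-local variation, the sharp log edition, and the covariant-out conversion -/

/-- ★ **§3 IN SUPPORT-LOCAL FORM** (for per-block `max_{read}` profiles): the adjacent transverse difference (direction `ι ≠ κ`) of the lifts' log-difference field at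
`⟨z,κ⟩, ⟨z+e_ι,κ⟩` is `≤ (L⁻¹)²·v` as soon as the coarse log-difference field `D := log X − log X′` has `‖D⟨y,κ⟩ − D⟨y+e_ι,κ⟩‖ ≤ v` on the cube COLUMN through `(z; κ, ι)`
only (the coarse sites `y` with non-zero column weight).  Same proof as §3 (linearity + ✓`norm_sub_shift_hat_le`). [cite: Balaban1985RegularSpaces, (1.29) p.81] -/
theorem norm_logVec_lift_rel_sub_shift_le_of_support (ht : t + 1 ≤ P.m + P.K) (w : PBond P t → PBond P (t + 1) → ℝ)
    (hw : ∀ b e, w b e = if e.dir = b.dir ∧ (b.src b.dir - emb e.src b.dir).val < P.L then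
      ∏ ν ∈ Finset.univ.erase b.dir, max 0 (1 - ((rel (emb e.src) b.src ν).natAbs : ℝ) / P.L) else 0)
    (X X' : GaugeField P (t + 1) SU2) (V V' : GaugeField P t SU2)
    (hV : ∀ b, V b = expPoint (∑ e, w b e • ((P.L : ℝ)⁻¹ • logVec (su2Quat (X e)))))
    (hV' : ∀ b, V' b = expPoint (∑ e, w b e • ((P.L : ℝ)⁻¹ • logVec (su2Quat (X' e)))))
    (z : Site P t) {ι κ : Fin P.d} (hικ : ι ≠ κ) {v : ℝ}
    (hv : ∀ y : Site P (t + 1), (if (z κ - emb y κ).val < P.L then (1 : ℝ) else 0) *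
          (∏ ν ∈ (Finset.univ.erase κ).erase ι, max 0 (1 - ((rel (emb y) z ν).natAbs : ℝ) / P.L)) *
          (if (z ι - emb y ι).val < P.L then (1 : ℝ) else 0) ≠ 0 →
      ‖(logVec (su2Quat (X ⟨y, κ⟩)) - logVec (su2Quat (X' ⟨y, κ⟩)))
        - (logVec (su2Quat (X ⟨y.shift ι, κ⟩)) - logVec (su2Quat (X' ⟨y.shift ι, κ⟩)))‖ ≤ v) :
    ‖(logVec (su2Quat (V ⟨z.shift ι, κ⟩)) - logVec (su2Quat (V' ⟨z.shift ι, κ⟩)))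
        - (logVec (su2Quat (V ⟨z, κ⟩)) - logVec (su2Quat (V' ⟨z, κ⟩)))‖ ≤ ((P.L : ℝ)⁻¹) ^ 2 * v := by
  have hL0 : 0 ≤ (P.L : ℝ)⁻¹ := inv_nonneg.mpr (Nat.cast_nonneg _)
  set A : PBond P (t + 1) → EuclideanSpace ℝ (Fin 3) :=
    fun e => (P.L : ℝ)⁻¹ • (logVec (su2Quat (X e)) - logVec (su2Quat (X' e))) with hA
  have ha : ∀ b, logVec (su2Quat (V b)) - logVec (su2Quat (V' b)) = ∑ e, w b e • A e := fun b => by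
    rw [logVec_lift ht w hw X V hV, logVec_lift ht w hw X' V' hV', ← Finset.sum_sub_distrib]
    refine Finset.sum_congr rfl fun e _ => ?_
    rw [hA]; dsimp only; rw [smul_sub, smul_sub]
  rw [ha, ha, norm_sub_rev]
  have h := norm_sub_shift_hat_le ht w hw A (fun b => ∑ e, w b e • A e) (fun _ => rfl) z hικ (M := (P.L : ℝ)⁻¹ * v)
    fun y hy => by
      rw [hA]; dsimp only
      rw [← smul_sub, norm_smul, Real.norm_eq_abs, abs_of_nonneg hL0]
      exact mul_le_mul_of_nonneg_left (hv y hy) hL0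
  refine h.trans (le_of_eq ?_)
  ring

/-- ★ **(R1)-sup, relative LOG on the left — SHARP CONSTANT under a fine relative-arc guard**: under §2's hypotheses, if moreover
`‖logVec (su2Quat (V b·V′ b⁻¹))‖ ≤ σ` with `σ² ≤ 3`, then `‖logVec (su2Quat (V b·V′ b⁻¹))‖ ≤ (1 + σ²∕3)·((1 + s²∕3)·(L⁻¹·m))` — `c_lift = (1+σ²∕3)(1+s²∕3) → 1`
(✓`norm_logVec_sub_le_mul_dist1` at `a₀ = 1` replaces Jordan's `π∕2`). [cite: Balaban1985RegularSpaces, (1.29) p.81] -/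
theorem norm_logVec_lift_rel_le_of_arc (ht : t + 1 ≤ P.m + P.K) (w : PBond P t → PBond P (t + 1) → ℝ)
    (hw : ∀ b e, w b e = if e.dir = b.dir ∧ (b.src b.dir - emb e.src b.dir).val < P.L then
      ∏ ν ∈ Finset.univ.erase b.dir, max 0 (1 - ((rel (emb e.src) b.src ν).natAbs : ℝ) / P.L) else 0)
    (X X' : GaugeField P (t + 1) SU2) (V V' : GaugeField P t SU2)
    (hV : ∀ b, V b = expPoint (∑ e, w b e • ((P.L : ℝ)⁻¹ • logVec (su2Quat (X e)))))
    (hV' : ∀ b, V' b = expPoint (∑ e, w b e • ((P.L : ℝ)⁻¹ • logVec (su2Quat (X' e)))))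
    (b : PBond P t) {s m σ : ℝ}
    (hs : ∀ e, w b e ≠ 0 → ‖logVec (su2Quat (X e))‖ ≤ s) (hs' : ∀ e, w b e ≠ 0 → ‖logVec (su2Quat (X' e))‖ ≤ s) (hs3 : s ^ 2 ≤ 3)
    (hm : ∀ e, w b e ≠ 0 → dist1 (X e * (X' e)⁻¹) ≤ m)
    (hσ : ‖logVec (su2Quat (V b * (V' b)⁻¹))‖ ≤ σ) (hσ3 : σ ^ 2 ≤ 3) :
    ‖logVec (su2Quat (V b * (V' b)⁻¹))‖ ≤ (1 + σ ^ 2 / 3) * ((1 + s ^ 2 / 3) * ((P.L : ℝ)⁻¹ * m)) := by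
  have hσ0 : 0 ≤ σ := (norm_nonneg _).trans hσ
  have h1 : ‖logVec (su2Quat (1 : SU2))‖ ≤ σ := by
    rw [FluctuationComparisonRegPrIntLS2BetaWhitneyHatLift.logVec_su2Quat_one, norm_zero]; exact hσ0
  have h := norm_logVec_sub_le_mul_dist1 (V b * (V' b)⁻¹) 1 hσ h1 hσ3
  rw [FluctuationComparisonRegPrIntLS2BetaWhitneyHatLift.logVec_su2Quat_one, sub_zero, inv_one, mul_one] at h
  exact h.trans (mul_le_mul_of_nonneg_left (dist1_lift_rel_le ht w hw X X' V V' hV hV' b hs hs' hs3 hm) (by positivity))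

/-- ★ **COVARIANT-OUT CONVERSION** for the `V`-row of the relative two-profile recursion: transporting one of two vectors by `g ∈ SU(2)` before differencing costs
`2·dist1 g ×` its size, `‖Ad_g Y′ − Y‖ ≤ ‖Y′ − Y‖ + 2·dist1 g·‖Y′‖` (✓`norm_adSU2_sub_self_le`, px13 g25).  With `g` a fine bond of the lift (`dist1 g ≤ L⁻¹·s`) and `Y′` a
relative chord (`≤ M`) this is the `T₂₁ ≈ 2·s·L⁻¹ × (lift row)` entry — the only place ABSOLUTE sizes enter the `V`-row. [folklore] -/
theorem norm_adSU2_sub_le_of_sub (g : SU2) (Y Y' : EuclideanSpace ℝ (Fin 3)) :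
    ‖B15Prop1ChartSU2.adSU2 g Y' - Y‖ ≤ ‖Y' - Y‖ + 2 * dist1 g * ‖Y'‖ := by
  calc ‖B15Prop1ChartSU2.adSU2 g Y' - Y‖ = ‖(B15Prop1ChartSU2.adSU2 g Y' - Y') + (Y' - Y)‖ := by rw [sub_add_sub_cancel]
    _ ≤ ‖B15Prop1ChartSU2.adSU2 g Y' - Y'‖ + ‖Y' - Y‖ := norm_add_le _ _
    _ ≤ 2 * dist1 g * ‖Y'‖ + ‖Y' - Y‖ := by
        have h := FluctuationComparisonRegPrIntLS2BetaCombTransporter.norm_adSU2_sub_self_le g Y'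
        linarith
    _ = ‖Y' - Y‖ + 2 * dist1 g * ‖Y'‖ := by ring

end Summit.QuantumFields.YangMills.Theorems.FluctuationComparisonRegPrIntLS2BetaWhitneyHatLiftRelativeSup
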